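import Summits.Ventures.HodgeRepro2.T5BergmanMatrixCoeff

/-!
# The monomial matrix coefficients are orthogonal in `L²(SU(1,1))`; the `K`-type projection of a
matrix coefficient

Fix `k ≥ 2`, `h ∈ A_k` and a Haar measure `μ` on `SU(1,1)`. The monomial coefficients
`c_m(g) = ⟨π_k(g) zᵐ, h⟩_k` satisfy `c_m(g · rot u) = u^{-(k+2m)} c_m(g)` (`matrixCoeff_monomial_mul_rot`),
so by the right-invariance of `μ` (`SU(1,1)` is unimodular) they are **pairwise orthogonal in `L²(μ)`**:
`∫ c_m c̄_n dμ = 0` for `m ≠ n` (`integral_monomial_mul_conj_eq_zero`). Consequently the square norm of the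
coefficient of a Taylor polynomial splits (`integral_norm_matrixCoeff_partialSum_sq`):

  `∫ |⟨π_k(g) S_N, h⟩_k|² dμ = Σ_{m<N} |a_m|² ∫ |⟨π_k(g) zᵐ, h⟩_k|² dμ`.

The second theme is the **`K`-type projection** of a matrix coefficient along the right `K`-orbit: for
`φ = Σ c_m zᵐ ∈ A_k`,

  `∫_K u^{k+2m} ⟨π_k(g · rot u) φ, h⟩_k du = c_m ⟨π_k(g) zᵐ, h⟩_k`   (`integral_circle_pow_mul_matrixCoeff`),

against the normalised Haar measure of the circle — the Fourier coefficient of the continuous function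
`u ↦ ⟨π_k(g · rot u) φ, h⟩_k` (first for Taylor polynomials, then by uniform approximation).

Blind lane: Mathlib + the HodgeRepro2 prefix only; no sorry; axioms ⊆ {propext, Classical.choice,
Quot.sound}.
-/

namespace Summit.Ventures.HodgeRepro2.T5BergmanCoeffOrtho

open MeasureTheory MeasureTheory.Measure Metric Filter Topology
open T5PoincareDensity T5SU11Unimodular T5SU11Fibration T5HaarCircle
open T5BergmanCoefficient T5BergmanPairing T5BergmanUnitary T5BergmanFourier T5BergmanKernel
  T5BergmanParseval T5BergmanPointwise T5BergmanProjection T5BergmanCoefficientL2 T5BergmanKTypes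
  T5BergmanActStable T5BergmanMatrixCoeff
open scoped Real

/-! ### Characters of the circle -/

/-- `conj ((u⁻¹)^p) = u^p` on the circle. -/
lemma conj_inv_pow (u : Circle) (p : ℕ) : (starRingEnd ℂ) (((u : ℂ)⁻¹) ^ p) = (u : ℂ) ^ p := by
  rw [map_pow, ← Circle.coe_inv, Circle.coe_inv_eq_conj, Complex.conj_conj]

/-- `conj (u^p) = (u⁻¹)^p` on the circle. -/
lemma conj_pow (u : Circle) (p : ℕ) : (starRingEnd ℂ) ((u : ℂ) ^ p) = ((u : ℂ)⁻¹) ^ p := by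
  rw [map_pow, ← Circle.coe_inv_eq_conj, Circle.coe_inv]

/-- `u ↦ (u⁻¹)^p` is continuous on the circle. -/
lemma continuous_coe_inv_pow (p : ℕ) : Continuous fun u : Circle => ((u : ℂ)⁻¹) ^ p := by
  simp_rw [← Circle.coe_inv]
  exact ((by fun_prop : Continuous fun u : Circle => (u : ℂ)).comp continuous_inv).pow p

/-- `u ↦ u^p (u⁻¹)^q` is continuous on the circle. -/
lemma continuous_coe_pow_mul_inv_pow (p q : ℕ) :
    Continuous fun u : Circle => (u : ℂ) ^ p * ((u : ℂ)⁻¹) ^ q :=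
  ((by fun_prop : Continuous fun u : Circle => (u : ℂ)).pow p).mul (continuous_coe_inv_pow q)

/-! ### Orthogonality in `L²(μ)` -/

/-- The product `F Ḡ` of two continuous square-integrable functions is integrable. -/
lemma integrable_mul_conj {μ : Measure SU11} {F G : SU11 → ℂ} (hF : Continuous F) (hG : Continuous G)
    (hF2 : Integrable (fun g => ‖F g‖ ^ 2) μ) (hG2 : Integrable (fun g => ‖G g‖ ^ 2) μ) :
    Integrable (fun g => F g * (starRingEnd ℂ) (G g)) μ := by
  refine ((hF2.add hG2).div_const 2).mono'
    (hF.mul (Complex.continuous_conj.comp hG)).aestronglyMeasurable ?_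
  exact Eventually.of_forall fun g => norm_mul_conj_le _ _

/-- **The monomial coefficients are orthogonal in `L²(μ)`**: `∫ ⟨π_k(g) zᵐ, h⟩_k conj ⟨π_k(g) zⁿ, h⟩_k dμ = 0`
for `m ≠ n` (right-invariance of `μ` under `rot u` and `u^{2(n-m)} ≠ 1` for a suitable `u`). -/
theorem integral_monomial_mul_conj_eq_zero (μ : Measure SU11) [IsHaarMeasure μ] (k : ℕ) (h : ℂ → ℂ)
    {m n : ℕ} (hmn : m ≠ n) (hm : Continuous (matrixCoeff k (fun w => w ^ m) h))
    (hn : Continuous (matrixCoeff k (fun w => w ^ n) h))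
    (hm2 : Integrable (fun g => ‖matrixCoeff k (fun w => w ^ m) h g‖ ^ 2) μ)
    (hn2 : Integrable (fun g => ‖matrixCoeff k (fun w => w ^ n) h g‖ ^ 2) μ) :
    ∫ g, matrixCoeff k (fun w => w ^ m) h g * (starRingEnd ℂ) (matrixCoeff k (fun w => w ^ n) h g) ∂μ
      = 0 := by
  have _hint := integrable_mul_conj hm hn hm2 hn2
  set I := ∫ g, matrixCoeff k (fun w => w ^ m) h g *
    (starRingEnd ℂ) (matrixCoeff k (fun w => w ^ n) h g) ∂μ with hI
  have key : ∀ u : Circle, I = ((u : ℂ)⁻¹) ^ (k + 2 * m) * (u : ℂ) ^ (k + 2 * n) * I := by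
    intro u
    rw [hI]
    conv_lhs => rw [← integral_mul_right μ _ (rot u)]
    simp_rw [matrixCoeff_monomial_mul_rot, map_mul, conj_inv_pow]
    rw [← integral_const_mul]
    congr 1
    funext g
    ring
  have hu0 : ∀ u : Circle, (u : ℂ) ≠ 0 := Circle.coe_ne_zero
  rcases lt_or_gt_of_ne hmn with hlt | hgt
  · obtain ⟨d, hd⟩ : ∃ d, n = m + (d + 1) := ⟨n - m - 1, by omega⟩
    obtain ⟨u, hu⟩ := exists_pow_eq_neg_one (d := 2 * (d + 1)) (by omega)
    have this := key u
    have e : ((u : ℂ)⁻¹) ^ (k + 2 * m) * (u : ℂ) ^ (k + 2 * n) = (u : ℂ) ^ (2 * (d + 1)) := by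
      have := hu0 u
      rw [hd, inv_pow]
      field_simp
      ring
    rw [e, hu] at this
    linear_combination (1 / 2 : ℂ) * this
  · obtain ⟨d, hd⟩ : ∃ d, m = n + (d + 1) := ⟨m - n - 1, by omega⟩
    obtain ⟨u, hu⟩ := exists_pow_eq_neg_one (d := 2 * (d + 1)) (by omega)
    have this := key u
    have e : ((u : ℂ)⁻¹) ^ (k + 2 * m) * (u : ℂ) ^ (k + 2 * n) = ((u : ℂ) ^ (2 * (d + 1)))⁻¹ := by
      have := hu0 u
      rw [hd, inv_pow]
      field_simp
      ring
    rw [e, hu] at this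
    norm_num at this
    linear_combination (1 / 2 : ℂ) * this

/-- **The square norm of the coefficient of a Taylor polynomial splits along the `K`-types**:
`∫ |⟨π_k(g) S_N, h⟩_k|² dμ = Σ_{m<N} |a_m|² ∫ |⟨π_k(g) zᵐ, h⟩_k|² dμ`, provided the monomial
coefficients are square-integrable. -/
theorem integral_norm_matrixCoeff_partialSum_sq (μ : Measure SU11) [IsHaarMeasure μ] (k : ℕ)
    (hk : 2 ≤ k) (a : ℕ → ℂ) (N : ℕ) (b : ℕ → ℂ) (h : ℂ → ℂ)
    (hh : ∀ w ∈ ball (0 : ℂ) 1, HasSum (fun n => b n * w ^ n) (h w))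
    (hhint : IntegrableOn (fun w => ‖h w‖ ^ 2 * (1 - ‖w‖ ^ 2) ^ (k - 2)) (ball (0 : ℂ) 1))
    (hm2 : ∀ m, Integrable (fun g => ‖matrixCoeff k (fun w => w ^ m) h g‖ ^ 2) μ) :
    ∫ g, ‖matrixCoeff k (partialSum a N) h g‖ ^ 2 ∂μ =
      ∑ m ∈ Finset.range N, ‖a m‖ ^ 2 * ∫ g, ‖matrixCoeff k (fun w => w ^ m) h g‖ ^ 2 ∂μ := by
  have hhc : ContinuousOn h (ball 0 1) := continuousOn_ball b h hh
  have hc : ∀ m, Continuous (matrixCoeff k (fun w => w ^ m) h) := fun m =>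
    continuous_matrixCoeff_monomial k hk m b h hh hhint
  set c : ℕ → SU11 → ℂ := fun m => matrixCoeff k (fun w => w ^ m) h with hcdef
  have hprod : ∀ m n, Integrable (fun g => c m g * (starRingEnd ℂ) (c n g)) μ := fun m n =>
    integrable_mul_conj (hc m) (hc n) (hm2 m) (hm2 n)
  apply Complex.ofReal_injective
  rw [← integral_complex_ofReal]
  have e : ∀ g : SU11, ((‖matrixCoeff k (partialSum a N) h g‖ ^ 2 : ℝ) : ℂ) =
      ∑ m ∈ Finset.range N, ∑ n ∈ Finset.range N,
        (a m * (starRingEnd ℂ) (a n)) * (c m g * (starRingEnd ℂ) (c n g)) := by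
    intro g
    rw [← Complex.normSq_eq_norm_sq, ← Complex.mul_conj, matrixCoeff_partialSum k hk a N h hhc hhint,
      _root_.map_sum, Finset.sum_mul_sum]
    refine Finset.sum_congr rfl fun m _ => Finset.sum_congr rfl fun n _ => ?_
    rw [map_mul]
    ring
  simp_rw [e]
  rw [integral_finsetSum _ (fun m _ => integrable_finsetSum _ (fun n _ => (hprod m n).const_mul _))]
  simp_rw [integral_finsetSum _ (fun n _ => (hprod _ n).const_mul _), integral_const_mul]
  push_cast
  refine Finset.sum_congr rfl fun m hm => ?_
  rw [Finset.sum_eq_single m]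
  · have e2 : ∀ g, c m g * (starRingEnd ℂ) (c m g) = ((‖c m g‖ ^ 2 : ℝ) : ℂ) := fun g => by
      rw [Complex.mul_conj, Complex.normSq_eq_norm_sq]
    simp_rw [e2]
    rw [integral_complex_ofReal, Complex.mul_conj, Complex.normSq_eq_norm_sq]
    push_cast
    ring
  · intro n _ hnm
    rw [integral_monomial_mul_conj_eq_zero μ k h (Ne.symm hnm) (hc m) (hc n) (hm2 m) (hm2 n), mul_zero]
  · intro hm'
    exact absurd hm hm'

/-- **Square-integrability of the coefficient of a Taylor polynomial** (Cauchy–Schwarz on the finite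
sum, given the monomial coefficients are square-integrable). -/
theorem integrable_norm_matrixCoeff_partialSum_sq (μ : Measure SU11) (k : ℕ) (hk : 2 ≤ k)
    (a : ℕ → ℂ) (N : ℕ) (b : ℕ → ℂ) (h : ℂ → ℂ)
    (hh : ∀ w ∈ ball (0 : ℂ) 1, HasSum (fun n => b n * w ^ n) (h w))
    (hhint : IntegrableOn (fun w => ‖h w‖ ^ 2 * (1 - ‖w‖ ^ 2) ^ (k - 2)) (ball (0 : ℂ) 1))
    (hm2 : ∀ m, Integrable (fun g => ‖matrixCoeff k (fun w => w ^ m) h g‖ ^ 2) μ) :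
    Integrable (fun g => ‖matrixCoeff k (partialSum a N) h g‖ ^ 2) μ := by
  have hhc : ContinuousOn h (ball 0 1) := continuousOn_ball b h hh
  have hcont : Continuous (matrixCoeff k (partialSum a N) h) :=
    continuous_matrixCoeff_partialSum k hk a N b h hh hhint
  refine ((integrable_finsetSum (Finset.range N) fun m _ => hm2 m).const_mul
    (∑ m ∈ Finset.range N, ‖a m‖ ^ 2)).mono' (hcont.norm.pow 2).aestronglyMeasurable ?_
  refine Eventually.of_forall fun g => ?_
  rw [Real.norm_eq_abs, abs_of_nonneg (by positivity), matrixCoeff_partialSum k hk a N h hhc hhint]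
  calc ‖∑ m ∈ Finset.range N, a m * matrixCoeff k (fun w => w ^ m) h g‖ ^ 2
      ≤ (∑ m ∈ Finset.range N, ‖a m‖ * ‖matrixCoeff k (fun w => w ^ m) h g‖) ^ 2 := by
        gcongr
        refine (norm_sum_le _ _).trans (Finset.sum_le_sum fun m _ => ?_)
        rw [norm_mul]
    _ ≤ (∑ m ∈ Finset.range N, ‖a m‖ ^ 2) *
          ∑ m ∈ Finset.range N, ‖matrixCoeff k (fun w => w ^ m) h g‖ ^ 2 :=
        Finset.sum_mul_sq_le_sq_mul_sq _ _ _

/-! ### The `K`-type projection of a matrix coefficient -/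

variable [MeasurableSpace Circle] [BorelSpace Circle]

/-- **Orthogonality of the characters** `u^{k+2m}` and `u^{k+2j}` of the circle:
`∫ u^{k+2m} (u⁻¹)^{k+2j} du = δ_{mj}` against the normalised Haar measure. -/
lemma integral_pow_mul_inv_pow (k m j : ℕ) :
    ∫ u : Circle, (u : ℂ) ^ (k + 2 * m) * ((u : ℂ)⁻¹) ^ (k + 2 * j) ∂haarCircle =
      if m = j then 1 else 0 := by
  have h := integral_zpow_mul_conj_zpow ((k + 2 * m : ℕ) : ℤ) ((k + 2 * j : ℕ) : ℤ)
  simp only [zpow_natCast, conj_pow, Nat.cast_inj] at h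
  rw [h]
  have e : k + 2 * m = k + 2 * j ↔ m = j := by omega
  simp only [e]


/-- **The `K`-type projection of the coefficient of a Taylor polynomial**: for `m < N`,
`∫_K u^{k+2m} ⟨π_k(g · rot u) S_N, h⟩_k du = a_m ⟨π_k(g) zᵐ, h⟩_k`. -/
theorem integral_circle_pow_mul_matrixCoeff_partialSum (k : ℕ) (hk : 2 ≤ k) (a : ℕ → ℂ) {N m : ℕ}
    (hmN : m < N) (h : ℂ → ℂ) (hh : ContinuousOn h (ball 0 1))
    (hhint : IntegrableOn (fun w => ‖h w‖ ^ 2 * (1 - ‖w‖ ^ 2) ^ (k - 2)) (ball (0 : ℂ) 1)) (g : SU11) :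
    ∫ u : Circle, (u : ℂ) ^ (k + 2 * m) * matrixCoeff k (partialSum a N) h (g * rot u) ∂haarCircle =
      a m * matrixCoeff k (fun w => w ^ m) h g := by
  simp_rw [matrixCoeff_partialSum_mul_rot k hk a N h hh hhint, Finset.mul_sum]
  have e : ∀ u : Circle, ∀ j, (u : ℂ) ^ (k + 2 * m) *
      (a j * (((u : ℂ)⁻¹) ^ (k + 2 * j) * matrixCoeff k (fun w => w ^ j) h g)) =
      (a j * matrixCoeff k (fun w => w ^ j) h g) * ((u : ℂ) ^ (k + 2 * m) * ((u : ℂ)⁻¹) ^ (k + 2 * j)) := by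
    intro u j
    ring
  simp_rw [e]
  rw [integral_finsetSum]
  · simp_rw [integral_const_mul, integral_pow_mul_inv_pow]
    rw [Finset.sum_eq_single m]
    · simp
    · intro j _ hjm
      rw [if_neg (Ne.symm hjm), mul_zero]
    · intro hm
      exact absurd (Finset.mem_range.mpr hmN) hm
  · intro j _
    refine (Integrable.const_mul ?_ _)
    exact (continuous_coe_pow_mul_inv_pow _ _).integrable_of_hasCompactSupport
      (HasCompactSupport.of_compactSpace _)

/-- **The `K`-type projection of a matrix coefficient**: for `φ = Σ c_m zᵐ ∈ A_k` holomorphic and `h ∈ A_k`,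
`∫_K u^{k+2m} ⟨π_k(g · rot u) φ, h⟩_k du = c_m ⟨π_k(g) zᵐ, h⟩_k` (uniform approximation by the Taylor
polynomials of `φ`, dominated convergence on the circle). -/
theorem integral_circle_pow_mul_matrixCoeff (k : ℕ) (hk : 2 ≤ k) (c : ℕ → ℂ) (φ : ℂ → ℂ)
    (hφ : DifferentiableOn ℂ φ (ball 0 1))
    (hφc : ∀ w ∈ ball (0 : ℂ) 1, HasSum (fun m => c m * w ^ m) (φ w))
    (hφint : IntegrableOn (fun w => ‖φ w‖ ^ 2 * (1 - ‖w‖ ^ 2) ^ (k - 2)) (ball (0 : ℂ) 1))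
    (b : ℕ → ℂ) (h : ℂ → ℂ) (hh : ∀ w ∈ ball (0 : ℂ) 1, HasSum (fun n => b n * w ^ n) (h w))
    (hhint : IntegrableOn (fun w => ‖h w‖ ^ 2 * (1 - ‖w‖ ^ 2) ^ (k - 2)) (ball (0 : ℂ) 1))
    (m : ℕ) (g : SU11) :
    ∫ u : Circle, (u : ℂ) ^ (k + 2 * m) * matrixCoeff k φ h (g * rot u) ∂haarCircle =
      c m * matrixCoeff k (fun w => w ^ m) h g := by
  have hhc : ContinuousOn h (ball 0 1) := continuousOn_ball b h hh
  set F : ℕ → Circle → ℂ := fun N u =>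
    (u : ℂ) ^ (k + 2 * m) * matrixCoeff k (partialSum c N) h (g * rot u) with hF
  set B : ℝ := Real.sqrt ((pairing k φ φ).re * (pairing k h h).re) with hB
  -- dominated convergence on the circle
  have hlim : Tendsto (fun N => ∫ u, F N u ∂haarCircle) atTop
      (𝓝 (∫ u : Circle, (u : ℂ) ^ (k + 2 * m) * matrixCoeff k φ h (g * rot u) ∂haarCircle)) := by
    refine tendsto_integral_of_dominated_convergence (fun _ => B) (fun N => ?_) (integrable_const B)
      (fun N => ?_) ?_
    · exact ((by fun_prop : Continuous fun u : Circle => (u : ℂ) ^ (k + 2 * m)).mul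
        ((continuous_matrixCoeff_partialSum k hk c N b h hh hhint).comp
          (continuous_const.mul continuous_rot))).aestronglyMeasurable
    · refine Eventually.of_forall fun u => ?_
      rw [hF]
      simp only
      rw [norm_mul, norm_pow, Circle.norm_coe, one_pow, one_mul]
      refine (norm_matrixCoeff_le k hk _ h (differentiable_partialSum c N).differentiableOn
        (integrableOn_partialSum k c N) hhc hhint _).trans (Real.sqrt_le_sqrt ?_)
      refine mul_le_mul_of_nonneg_right ?_ (pairing_self_nonneg k h).1
      rw [pairing_partialSum_self k hk c N]
      exact bessel k hk c φ hφc hφint N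
    · refine Eventually.of_forall fun u => ?_
      rw [hF]
      simp only
      refine Tendsto.const_mul _ ?_
      -- uniform approximation in the first slot
      rw [tendsto_iff_norm_sub_tendsto_zero]
      have h1 := (tendsto_pairing_sub_partialSum k hk c φ hφc hφint).mul_const (pairing k h h).re
      rw [zero_mul] at h1
      have h2 := h1.sqrt
      rw [Real.sqrt_zero] at h2
      refine squeeze_zero (fun N => norm_nonneg _) (fun N => ?_) h2
      rw [norm_sub_rev]
      exact norm_matrixCoeff_sub_partialSum_left_le k hk c φ hφ hφc hφint h hhc hhint N _
  -- the integrals are eventually constant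
  have hconst : Tendsto (fun N => ∫ u, F N u ∂haarCircle) atTop
      (𝓝 (c m * matrixCoeff k (fun w => w ^ m) h g)) := by
    refine tendsto_const_nhds.congr' ?_
    filter_upwards [eventually_gt_atTop m] with N hN
    exact (integral_circle_pow_mul_matrixCoeff_partialSum k hk c hN h hhc hhint g).symm
  exact tendsto_nhds_unique hlim hconst

end Summit.Ventures.HodgeRepro2.T5BergmanCoeffOrtho
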